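import Summits.Schanuel.Schanuel.Theses.TateNomes
import HarnessLib.Audit

/-!
# Line `integer-shift-rebase` — skeleton for crux `TateNomes.NomeHygiene`
(item stmt-Schanuel-17298, route route-Schanuel-TateNomes; crux-strategist before the lead,
planner-cstrat-stmt-Schanuel-17298-b1-0, 2026-08-17; line card `Lines/integer-shift-rebase.md`)

**The crux.** Every `ℚ`-linearly independent `z : Fin n → ℂ` enlarges by finitely many `eᵢ` with
`eᵢ ∈ ℚ̄` or `exp eᵢ ∈ ℚ̄` so that `span_ℚ(z, e)` has a basis `w` in *Tate position*:
`2πi ∈ span w`, `Re wⱼ < 0`, `τⱼ = wⱼ/2πi` not a root of a rational quadratic, and the `τⱼ`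
pairwise `GL₂⁺(ℚ)`-inequivalent (in the polynomial form `τⱼ (c τᵢ + d) ≠ a τᵢ + b`, `ad - bc > 0`).

**The lever (integer shifts along the cusp direction).** Work in `V = span_ℚ(z, e)` after the
enlargement has put `1` and `2πi` into `V` and made `dim V ≥ 3` (`enlarge`, PROVED here: adjoin
`2πi` — `exp 2πi = 1` —, then `1`, then `√2`, each only if missing).  Take a `ℚ`-basis
`(2πi, 1, u₁, …, u_m)` of `V`, `m ≥ 1` (`periodBasis_exists`, PROVED here) and SHIFT BY NATURALS:

  `w_j = u_j − A_j (j ≤ m)`,  `w_{m+1} = 2πi + u₁ − B`,  `w_{m+2} = 4πi + u₁ − C`,  `A_j, B, C ∈ ℕ`.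

`Re w < 0` once the shifts exceed the real parts; `w` is a basis of `V` iff `C − 2B + A₁ ≠ 0`
(determinant in the coordinates `(2πi, 1, u)`); `2πi ∈ V = span w`.  In nome coordinates
`τ = w/2πi = x + t·y` with base point `x = β/2πi` (`β ∈ {u_j, 2πi + u₁, 4πi + u₁}`), shift `t ∈ ℕ`
and the TRANSCENDENTAL direction `y = −1/2πi` (Lindemann; tree
`Literature.NumberTheory.Transcendental.transcendental_two_pi_I`), where `1, x, y` are
`ℚ`-independent because `(1, 2πi, β)` is.  Two counting facts make a good choice of shifts exist,
slot by slot, by finite avoidance in `ℕ`: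
* `x + t·y` is algebraic for at most ONE rational `t` (two would make `(t − t')·y` algebraic);
* KEY LEMMA (`stub_shiftCoincidence`): for every `p ∈ ℂ` at most TWO rational `t` make `x + t·y`
  `GL₂⁺(ℚ)`-related to `p` (either direction).  Sketch: the relation is symmetric (adjugate) and
  transitive (matrix product) as polynomial identities, so three bad `t₁, t₂, t₃` give pairwise
  relations `(x+t₂y)(c(x+t₁y)+d) = a(x+t₁y)+b`; `c = 0` contradicts the independence of `1, x, y`
  (`t₁ = t₂`), so `(x+tᵢy)(x+tⱼy) ∈ P := span_ℚ(1, x, y)` for all three pairs; differences give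
  `(x+t₁y)y, (x+t₂y)y ∈ P`, hence `y², xy, y³ ∈ P`, so `1, y, y², y³` lie in the 3-dimensional `P`
  and `y` is algebraic of degree `≤ 3` — contradiction.
No case analysis on algebraic relations among the `zᵢ` is needed: coincidences are dodged slot
by slot (the route's worry `span(1, τ₀, −1/τ₀)` and the refuter's cubic-field cell
`z = (2πi, 2πiτ₀, 2πiτ₀²)` are both repaired with `k ≤ 1`; the degenerate cells `n = 0`,
`span z ⊆ ℚ ⊕ ℚ·2πi` need the padding to `dim V = 3` — for `V = ℚ ⊕ ℚ·2πi` every pair of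
Tate candidates is affinely `GL₂⁺(ℚ)`-related (grounder g76-1 / refuter rreview-0817T01-2-0) —,
which is exactly why `enlarge` delivers `3 ≤ n + k` and `stub_shiftedTateBasis` asks `1 ≤ m`).

**Registered stubs** (sorries live ONLY here; signatures over Mathlib declarations only —
verbatim expansions, no local `def` — so that each lands as a pure `--supports` proof):
* `stub_shiftCoincidence` — the KEY LEMMA, in `V`-coordinates: for `(1, 2πi, β)` `ℚ`-independent
  and any `p`, only finitely many `t : ℚ` make `(β − t)/2πi` and `p` `GL₂⁺(ℚ)`-related in either
  direction (the mathematical heart; hardest by content).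
* `stub_shiftedTateBasis` — KEY LEMMA ⟹ for `(2πi, 1, u)` independent with `m ≥ 1` there is a
  Tate-position basis `w : Fin (m+2) → ℂ` of the same span with every `wⱼ/2πi` TRANSCENDENTAL
  (the shifted family above; sequential finite avoidance + the determinant `C − 2B + A₁`; largest
  by Lean size).
Everything else in this file is sorry-free: `enlarge` (the crux's enlargement step, `k ≤ 3`),
`periodBasis_exists` (re-basing through the periods `2πi, 1`), the reindexing transport and the
composition `NomeHygiene_of`, which glues BY NAME — enlarge, re-base, shift (consuming the Key
Lemma by name), transport `Fin (m+2) ≃ Fin (n+k)`, and read off the crux's seven conjuncts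
(transcendental ⟹ not quadratic over `ℚ`).

Disproof.lean: none published for this crux at the time of writing (`ledger crux ls` showed no
workfiles; no `_false_without_` theorem, no landed Negative lemma) — nothing to honour or avoid;
the two recorded degenerate cells (grounder g76-1, refuter route-review) are answered above.
Negatives index (`ledger negatives --problem Schanuel`): no statement of this shape.
-/

noncomputable section

-- `Summit.Schanuel.Schanuel.…` is the mandated summit/sub-problem namespace (single-conjunct summit), hence:
set_option linter.dupNamespace false

open Complex

namespace Summit.Schanuel.Schanuel.Cruxes.NomeHygiene.IntegerShiftRebase

/-! ### The registered stubs (signatures over existing declarations only) -/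

/-- **Stub 1 — `ShiftCoincidence` (KEY LEMMA; the mathematical heart).** If `(1, 2πi, β)` is
`ℚ`-linearly independent then for every `p ∈ ℂ` only finitely many (in fact at most two per
direction) rational shifts `t` make `τ_t := (β − t)/2πi` and `p` related by an element of
`GL₂⁺(ℚ)` — in the route's polynomial form `τ' (c τ + d) = a τ + b`, `ad − bc > 0`, either
direction.  Write `τ_t = x + t·y`, `x = β/2πi`, `y = −1/2πi` (transcendental, tree
`Literature.NumberTheory.Transcendental.transcendental_two_pi_I`), `1, x, y` `ℚ`-independent.
The relation is symmetric (adjugate matrix) and transitive (product) as polynomial identities —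
no non-vanishing of `cτ + d` is needed —, so three bad shifts give pairwise relations among the
`x + tᵢy`; `c = 0` forces `tᵢ = tⱼ` by independence, and `c ≠ 0` puts `(x+tᵢy)(x+tⱼy)` in
`P = span_ℚ(1,x,y)` for all pairs, whence `y², xy, y³ ∈ P` and `1, y, y², y³` are `ℚ`-dependent
(`finrank_span_le_card`): `y` algebraic, contradiction.  (If `p ∈ ℚ` the set is empty: a
relation with `τ ∉ ℚ` forces `a = pc`, `b = pd`, determinant `0`.)  Size M. -/
theorem stub_shiftCoincidence :
    ∀ (β p : ℂ), LinearIndependent ℚ ![(1 : ℂ), 2 * (Real.pi : ℂ) * Complex.I, β] →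
      Set.Finite {t : ℚ | ∃ a b c d : ℚ, 0 < a * d - b * c ∧
        ((β - (t : ℂ)) / (2 * (Real.pi : ℂ) * Complex.I) * ((c : ℂ) * p + (d : ℂ)) =
            (a : ℂ) * p + (b : ℂ) ∨
         p * ((c : ℂ) * ((β - (t : ℂ)) / (2 * (Real.pi : ℂ) * Complex.I)) + (d : ℂ)) =
            (a : ℂ) * ((β - (t : ℂ)) / (2 * (Real.pi : ℂ) * Complex.I)) + (b : ℂ))} := by
  sorry

/-- **Stub 2 — `ShiftedTateBasis` (the construction; consumes the Key Lemma BY NAME).** Assume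
the Key Lemma (`stub_shiftCoincidence`, verbatim).  Let `(2πi, 1, u₁, …, u_m)` be `ℚ`-linearly
independent with `m ≥ 1`.  Then its span has a `ℚ`-basis `w : Fin (m+2) → ℂ` in Tate position with
every `wⱼ/2πi` transcendental: take `w_j = u_j − A_j`, `w_{m+1} = 2πi + u₁ − B`,
`w_{m+2} = 4πi + u₁ − C` with natural numbers chosen one slot at a time outside a finite bad set
(real parts: `A_j > Re u_j`; algebraicity of `(β − t)/2πi`: at most one `t`, since two would make
`2πi` algebraic; `GL₂⁺(ℚ)`-coincidence with each earlier slot: finitely many `t` by the Key Lemma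
at `β ∈ {u_j, 2πi + u₁, 4πi + u₁}`, where `(1, 2πi, β)` is independent as a sub-family of the
basis; basis condition `C − 2B + A₁ ≠ 0`).  Independence of `w`: if `Σ cⱼ wⱼ = 0`, the
`2πi`-coordinate gives `c_{m+1} = −2c_{m+2}`, the `u_j`-coordinates (`j ≥ 2`) give `c_j = 0`, the
`u₁`-coordinate gives `c₁ = c_{m+2}`, and the `1`-coordinate gives `(2B − A₁ − C) c_{m+2} = 0`;
`span w = span (2πi, 1, u)` by `finrank` (independent of full cardinality inside it).  Size M–L
(the `Fin (m+2)` bookkeeping dominates; see the determinant-free independence argument above). -/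
theorem stub_shiftedTateBasis :
    (∀ (β p : ℂ), LinearIndependent ℚ ![(1 : ℂ), 2 * (Real.pi : ℂ) * Complex.I, β] →
      Set.Finite {t : ℚ | ∃ a b c d : ℚ, 0 < a * d - b * c ∧
        ((β - (t : ℂ)) / (2 * (Real.pi : ℂ) * Complex.I) * ((c : ℂ) * p + (d : ℂ)) =
            (a : ℂ) * p + (b : ℂ) ∨
         p * ((c : ℂ) * ((β - (t : ℂ)) / (2 * (Real.pi : ℂ) * Complex.I)) + (d : ℂ)) =
            (a : ℂ) * ((β - (t : ℂ)) / (2 * (Real.pi : ℂ) * Complex.I)) + (b : ℂ))}) →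
    ∀ (m : ℕ) (u : Fin m → ℂ), 1 ≤ m →
      LinearIndependent ℚ
        (Fin.cons (2 * (Real.pi : ℂ) * Complex.I) (Fin.cons (1 : ℂ) u) : Fin (m + 2) → ℂ) →
      ∃ w : Fin (m + 2) → ℂ, LinearIndependent ℚ w ∧
        Submodule.span ℚ (Set.range w) = Submodule.span ℚ (Set.range
          (Fin.cons (2 * (Real.pi : ℂ) * Complex.I) (Fin.cons (1 : ℂ) u) : Fin (m + 2) → ℂ)) ∧
        (∀ j, (w j).re < 0) ∧
        (∀ j, Transcendental ℚ (w j / (2 * (Real.pi : ℂ) * Complex.I))) ∧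
        (∀ i j, i ≠ j → ∀ a b c d : ℚ, 0 < a * d - b * c →
          (w j / (2 * (Real.pi : ℂ) * Complex.I)) *
              ((c : ℂ) * (w i / (2 * (Real.pi : ℂ) * Complex.I)) + (d : ℂ)) ≠
            (a : ℂ) * (w i / (2 * (Real.pi : ℂ) * Complex.I)) + (b : ℂ)) := by
  sorry

/-! ### Sorry-free glue, part 1: the ENLARGEMENT step of the crux (`k ≤ 3`) -/

/-- The range of `Fin.snoc v x` is `range v ∪ {x}`. -/
theorem range_fin_snoc {α : Type*} {n : ℕ} (v : Fin n → α) (x : α) :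
    Set.range (Fin.snoc v x : Fin (n + 1) → α) = Set.range v ∪ {x} := by
  ext a
  constructor
  · rintro ⟨i, rfl⟩
    refine Fin.lastCases ?_ (fun j => ?_) i
    · right
      simp [Fin.snoc_last]
    · left
      exact ⟨j, by simp [Fin.snoc_castSucc]⟩
  · rintro (⟨j, rfl⟩ | h)
    · exact ⟨Fin.castSucc j, by simp [Fin.snoc_castSucc]⟩
    · rw [Set.mem_singleton_iff] at h
      subst h
      exact ⟨Fin.last n, by simp [Fin.snoc_last]⟩

/-- One enlargement step: adjoin `x` (algebraic, or with algebraic exponential) to the running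
independent family `v` (with `range v = range z ∪ range e`, `e` the numbers adjoined so far) if
and only if it is missing from the span. -/
theorem enlarge_step (n : ℕ) (z : Fin n → ℂ) (x : ℂ)
    (hx : IsAlgebraic ℚ x ∨ IsAlgebraic ℚ (Complex.exp x))
    (k N : ℕ) (e : Fin k → ℂ) (v : Fin N → ℂ) (hN : N = n + k)
    (he : ∀ i, IsAlgebraic ℚ (e i) ∨ IsAlgebraic ℚ (Complex.exp (e i)))
    (hv : LinearIndependent ℚ v) (hr : Set.range v = Set.range z ∪ Set.range e) :
    ∃ (k' N' : ℕ) (e' : Fin k' → ℂ) (v' : Fin N' → ℂ), N' = n + k' ∧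
      (∀ i, IsAlgebraic ℚ (e' i) ∨ IsAlgebraic ℚ (Complex.exp (e' i))) ∧
      LinearIndependent ℚ v' ∧ Set.range v' = Set.range z ∪ Set.range e' ∧
      x ∈ Submodule.span ℚ (Set.range v') ∧ Set.range v ⊆ Set.range v' := by
  by_cases hmem : x ∈ Submodule.span ℚ (Set.range v)
  · exact ⟨k, N, e, v, hN, he, hv, hr, hmem, subset_rfl⟩
  · refine ⟨k + 1, N + 1, Fin.snoc e x, Fin.snoc v x, by omega, ?_, ?_, ?_, ?_, ?_⟩
    · intro i
      refine Fin.lastCases ?_ (fun j => ?_) i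
      · simpa [Fin.snoc_last] using hx
      · simpa [Fin.snoc_castSucc] using he j
    · exact linearIndependent_finSnoc.2 ⟨hv, hmem⟩
    · rw [range_fin_snoc, range_fin_snoc, hr, Set.union_assoc]
    · apply Submodule.subset_span
      rw [range_fin_snoc]
      exact Or.inr rfl
    · rw [range_fin_snoc]
      exact Set.subset_union_left

/-- `√2` is algebraic over `ℚ` (as a complex number). -/
theorem isAlgebraic_sqrt_two : IsAlgebraic ℚ ((Real.sqrt 2 : ℝ) : ℂ) := by
  refine ⟨Polynomial.X ^ 2 - Polynomial.C 2, Polynomial.Monic.ne_zero (by monicity!), ?_⟩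
  have h2 : ((Real.sqrt 2 : ℝ) : ℂ) ^ 2 = 2 := by
    rw [← Complex.ofReal_pow, Real.sq_sqrt (by norm_num : (0 : ℝ) ≤ 2)]
    push_cast
    rfl
  simp only [map_sub, map_pow, Polynomial.aeval_X, Polynomial.aeval_C, eq_ratCast, h2]
  push_cast
  ring

/-- `exp (2πi) = 1` is algebraic. -/
theorem isAlgebraic_exp_two_pi_I :
    IsAlgebraic ℚ (Complex.exp (2 * (Real.pi : ℂ) * Complex.I)) := by
  rw [Complex.exp_two_pi_mul_I]
  exact isAlgebraic_one

/-- `1, 2πi, √2` are `ℚ`-linearly independent (`2πi ∉ ℝ`, `√2 ∉ ℚ`). -/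
theorem linearIndependent_one_twoPiI_sqrt_two :
    LinearIndependent ℚ ![(1 : ℂ), 2 * (Real.pi : ℂ) * Complex.I, ((Real.sqrt 2 : ℝ) : ℂ)] := by
  rw [Fintype.linearIndependent_iff]
  intro g hg
  rw [Fin.sum_univ_three] at hg
  simp only [Matrix.cons_val_zero, Matrix.cons_val_one, Matrix.head_cons,
    Matrix.cons_val_two, Matrix.tail_cons] at hg
  have him : ((g 1 : ℚ) : ℝ) * (2 * Real.pi) = 0 := by
    have h := congrArg Complex.im hg
    simp only [Complex.add_im, Rat.smul_def, Complex.mul_im, Complex.mul_re, Complex.ratCast_re,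
      Complex.ratCast_im, Complex.one_im, Complex.one_re, Complex.ofReal_im, Complex.ofReal_re,
      Complex.I_im, Complex.I_re, Complex.re_ofNat, Complex.im_ofNat, Complex.zero_im] at h
    linear_combination h
  have hre : ((g 0 : ℚ) : ℝ) + ((g 2 : ℚ) : ℝ) * Real.sqrt 2 = 0 := by
    have h := congrArg Complex.re hg
    simp only [Complex.add_re, Rat.smul_def, Complex.mul_im, Complex.mul_re, Complex.ratCast_re,
      Complex.ratCast_im, Complex.one_im, Complex.one_re, Complex.ofReal_im, Complex.ofReal_re,
      Complex.I_im, Complex.I_re, Complex.re_ofNat, Complex.im_ofNat, Complex.zero_re] at h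
    linear_combination h
  have h1 : g 1 = 0 := by
    have : ((g 1 : ℚ) : ℝ) = 0 := (mul_eq_zero.1 him).resolve_right (by positivity)
    exact_mod_cast this
  have h2 : g 2 = 0 := by
    by_contra hne
    have hirr : Irrational (((g 0 : ℚ) : ℝ) + ((g 2 : ℚ) : ℝ) * Real.sqrt 2) :=
      (irrational_sqrt_two.ratCast_mul hne).ratCast_add (g 0)
    exact hirr ⟨0, by push_cast; linarith [hre]⟩
  have h0 : g 0 = 0 := by
    have : ((g 0 : ℚ) : ℝ) = 0 := by
      rw [h2] at hre
      push_cast at hre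
      linarith [hre]
    exact_mod_cast this
  intro i
  fin_cases i
  · exact h0
  · exact h1
  · exact h2

/-- **`Enlarge`** (PROVED; the crux's enlargement step).  Every `ℚ`-linearly independent
`z : Fin n → ℂ` extends by `k ≤ 3` numbers `eᵢ`, each algebraic or with algebraic exponential
(`2πi` if missing, then `1`, then `√2`), to an independent family `v : Fin N → ℂ`, `N = n + k`,
`range v = range z ∪ range e`, whose span contains `1` and `2πi` and has dimension `N ≥ 3`
(dimension count: `1, 2πi, √2` lie in the span and are independent). -/
theorem enlarge (n : ℕ) (z : Fin n → ℂ) (hz : LinearIndependent ℚ z) :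
    ∃ (k N : ℕ) (e : Fin k → ℂ) (v : Fin N → ℂ), N = n + k ∧
      (∀ i, IsAlgebraic ℚ (e i) ∨ IsAlgebraic ℚ (Complex.exp (e i))) ∧
      LinearIndependent ℚ v ∧ Set.range v = Set.range z ∪ Set.range e ∧
      (1 : ℂ) ∈ Submodule.span ℚ (Set.range v) ∧
      (2 * (Real.pi : ℂ) * Complex.I) ∈ Submodule.span ℚ (Set.range v) ∧ 3 ≤ N := by
  have h0 : Set.range z = Set.range z ∪ Set.range (Fin.elim0 : Fin 0 → ℂ) := by
    rw [Set.range_eq_empty Fin.elim0, Set.union_empty]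
  obtain ⟨k₁, N₁, e₁, v₁, hN₁, he₁, hv₁, hr₁, hx₁, -⟩ :=
    enlarge_step n z (2 * (Real.pi : ℂ) * Complex.I) (Or.inr isAlgebraic_exp_two_pi_I) 0 n
      Fin.elim0 z (by omega) (fun i => Fin.elim0 i) hz h0
  obtain ⟨k₂, N₂, e₂, v₂, hN₂, he₂, hv₂, hr₂, hx₂, hsub₂⟩ :=
    enlarge_step n z (1 : ℂ) (Or.inl isAlgebraic_one) k₁ N₁ e₁ v₁ hN₁ he₁ hv₁ hr₁
  obtain ⟨k₃, N₃, e₃, v₃, hN₃, he₃, hv₃, hr₃, hx₃, hsub₃⟩ :=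
    enlarge_step n z ((Real.sqrt 2 : ℝ) : ℂ) (Or.inl isAlgebraic_sqrt_two) k₂ N₂ e₂ v₂ hN₂ he₂
      hv₂ hr₂
  have h1 : (1 : ℂ) ∈ Submodule.span ℚ (Set.range v₃) := Submodule.span_mono hsub₃ hx₂
  have h2 : (2 * (Real.pi : ℂ) * Complex.I) ∈ Submodule.span ℚ (Set.range v₃) :=
    Submodule.span_mono (hsub₂.trans hsub₃) hx₁
  refine ⟨k₃, N₃, e₃, v₃, hN₃, he₃, hv₃, hr₃, h1, h2, ?_⟩
  -- dimension count inside `W = span (range v₃)`: `1, 2πi, √2 ∈ W` are independent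
  set W : Submodule ℚ ℂ := Submodule.span ℚ (Set.range v₃) with hW
  haveI : FiniteDimensional ℚ W := FiniteDimensional.span_of_finite ℚ (Set.finite_range v₃)
  have hfin : Module.finrank ℚ W = N₃ := by
    rw [hW, finrank_span_eq_card hv₃, Fintype.card_fin]
  let g : Fin 3 → W :=
    ![⟨(1 : ℂ), h1⟩, ⟨2 * (Real.pi : ℂ) * Complex.I, h2⟩, ⟨((Real.sqrt 2 : ℝ) : ℂ), hx₃⟩]
  have hg : W.subtype ∘ g =
      ![(1 : ℂ), 2 * (Real.pi : ℂ) * Complex.I, ((Real.sqrt 2 : ℝ) : ℂ)] := by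
    funext i
    fin_cases i <;> rfl
  have hlig : LinearIndependent ℚ g := by
    apply LinearIndependent.of_comp W.subtype
    rw [hg]
    exact linearIndependent_one_twoPiI_sqrt_two
  have := hlig.fintype_card_le_finrank
  rw [Fintype.card_fin, hfin] at this
  exact this

/-! ### Sorry-free glue, part 2: RE-BASING THROUGH THE PERIODS `(2πi, 1, u₁, …, u_m)` -/

/-- `2πi` is not a rational multiple of `1`: the pair `(2πi, 1)` heads a `ℚ`-independent family. -/
theorem linearIndependent_twoPiI_one :
    LinearIndependent ℚ
      (Fin.cons (2 * (Real.pi : ℂ) * Complex.I) (Fin.cons (1 : ℂ) (Fin.elim0 : Fin 0 → ℂ)) :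
        Fin 2 → ℂ) := by
  rw [linearIndependent_finCons, linearIndependent_finCons]
  refine ⟨⟨linearIndependent_empty_type, ?_⟩, ?_⟩
  · have : Set.range (Fin.elim0 : Fin 0 → ℂ) = ∅ := Set.range_eq_empty _
    rw [this, Submodule.span_empty]
    simp
  · intro hmem
    have hr : Set.range (Fin.cons (1 : ℂ) (Fin.elim0 : Fin 0 → ℂ) : Fin 1 → ℂ) = {(1 : ℂ)} := by
      rw [Fin.range_cons, Set.range_eq_empty, Set.insert_eq, Set.union_empty]
    rw [hr, Submodule.mem_span_singleton] at hmem
    obtain ⟨q, hq⟩ := hmem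
    have him := congrArg Complex.im hq
    simp at him

/-- Inductive extension inside `W`: a `ℚ`-independent family `(2πi, 1, u)` with values in a
finite-dimensional subspace `W ∋ 1, 2πi` of dimension `≥ j + 2` exists for every such `j`. -/
theorem periodBasis_aux (W : Submodule ℚ ℂ) [FiniteDimensional ℚ W]
    (h1 : (1 : ℂ) ∈ W) (h2 : (2 * (Real.pi : ℂ) * Complex.I) ∈ W) :
    ∀ j : ℕ, j + 2 ≤ Module.finrank ℚ W →
      ∃ u : Fin j → ℂ, (∀ i, u i ∈ W) ∧
        LinearIndependent ℚ
          (Fin.cons (2 * (Real.pi : ℂ) * Complex.I) (Fin.cons (1 : ℂ) u) : Fin (j + 2) → ℂ) := by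
  intro j
  induction j with
  | zero =>
    intro _
    exact ⟨Fin.elim0, fun i => Fin.elim0 i, linearIndependent_twoPiI_one⟩
  | succ j ih =>
    intro hj
    obtain ⟨u, huW, hli⟩ := ih (by omega)
    -- lift the family to `W`
    set f : Fin (j + 2) → ℂ :=
      (Fin.cons (2 * (Real.pi : ℂ) * Complex.I) (Fin.cons (1 : ℂ) u) : Fin (j + 2) → ℂ) with hf
    have hfW : ∀ i, f i ∈ W := by
      intro i
      refine Fin.cases ?_ (fun i => ?_) i
      · simpa [hf] using h2
      · refine Fin.cases ?_ (fun i => ?_) i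
        · simpa [hf] using h1
        · simpa [hf] using huW i
    let f' : Fin (j + 2) → W := fun i => ⟨f i, hfW i⟩
    have hf'f : W.subtype ∘ f' = f := by
      funext i
      rfl
    have hli' : LinearIndependent ℚ f' := by
      apply LinearIndependent.of_comp W.subtype
      rw [hf'f]
      exact hli
    obtain ⟨b, hb⟩ := exists_linearIndependent_snoc_of_lt_finrank hli' (by omega)
    have hbC : LinearIndependent ℚ (W.subtype ∘ Fin.snoc f' b) :=
      hb.map' W.subtype (Submodule.ker_subtype W)
    have hsnoc : (W.subtype ∘ Fin.snoc f' b : Fin (j + 2 + 1) → ℂ) = Fin.snoc f (b : ℂ) := by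
      funext i
      refine Fin.lastCases ?_ (fun i => ?_) i
      · simp [Fin.snoc_last]
      · simp only [Function.comp_apply, Fin.snoc_castSucc]
        rfl
    rw [hsnoc] at hbC
    refine ⟨Fin.snoc u (b : ℂ), ?_, ?_⟩
    · intro i
      refine Fin.lastCases ?_ (fun i => ?_) i
      · simp [Fin.snoc_last]
      · simpa [Fin.snoc_castSucc] using huW i
    · have e : (Fin.cons (2 * (Real.pi : ℂ) * Complex.I) (Fin.cons (1 : ℂ) (Fin.snoc u (b : ℂ))) :
          Fin (j + 1 + 2) → ℂ) = Fin.snoc f (b : ℂ) := by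
        rw [hf, ← Fin.cons_snoc_eq_snoc_cons, ← Fin.cons_snoc_eq_snoc_cons]
      rw [e]
      exact hbC

/-- **`PeriodBasis`** (PROVED).  If `v : Fin N → ℂ` is `ℚ`-linearly independent and its span
contains `1` and `2πi`, the span has a `ℚ`-basis `(2πi, 1, u₁, …, u_m)` with `N = m + 2`. -/
theorem periodBasis_exists (N : ℕ) (v : Fin N → ℂ) (hv : LinearIndependent ℚ v)
    (h1 : (1 : ℂ) ∈ Submodule.span ℚ (Set.range v))
    (h2 : (2 * (Real.pi : ℂ) * Complex.I) ∈ Submodule.span ℚ (Set.range v)) :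
    ∃ (m : ℕ) (u : Fin m → ℂ), N = m + 2 ∧
      LinearIndependent ℚ
        (Fin.cons (2 * (Real.pi : ℂ) * Complex.I) (Fin.cons (1 : ℂ) u) : Fin (m + 2) → ℂ) ∧
      Submodule.span ℚ (Set.range
        (Fin.cons (2 * (Real.pi : ℂ) * Complex.I) (Fin.cons (1 : ℂ) u) : Fin (m + 2) → ℂ)) =
        Submodule.span ℚ (Set.range v) := by
  set W : Submodule ℚ ℂ := Submodule.span ℚ (Set.range v) with hW
  haveI : FiniteDimensional ℚ W := FiniteDimensional.span_of_finite ℚ (Set.finite_range v)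
  have hfin : Module.finrank ℚ W = N := by
    rw [hW, finrank_span_eq_card hv, Fintype.card_fin]
  -- `N ≥ 2`: the independent pair `(2πi, 1)` lives in `W`
  have hN2 : 2 ≤ N := by
    let g : Fin 2 → W := Fin.cons ⟨2 * (Real.pi : ℂ) * Complex.I, h2⟩
      (Fin.cons ⟨(1 : ℂ), h1⟩ (Fin.elim0 : Fin 0 → W))
    have hg : W.subtype ∘ g =
        (Fin.cons (2 * (Real.pi : ℂ) * Complex.I) (Fin.cons (1 : ℂ) (Fin.elim0 : Fin 0 → ℂ)) :
          Fin 2 → ℂ) := by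
      funext i
      refine Fin.cases ?_ (fun i => ?_) i
      · rfl
      · refine Fin.cases ?_ (fun i => ?_) i
        · rfl
        · exact Fin.elim0 i
    have hlig : LinearIndependent ℚ g := by
      apply LinearIndependent.of_comp W.subtype
      rw [hg]
      exact linearIndependent_twoPiI_one
    have := hlig.fintype_card_le_finrank
    rw [Fintype.card_fin, hfin] at this
    exact this
  obtain ⟨u, huW, hli⟩ := periodBasis_aux W h1 h2 (N - 2) (by omega)
  refine ⟨N - 2, u, by omega, hli, ?_⟩
  -- the independent family of full cardinality inside `W` spans `W`
  apply Submodule.eq_of_le_of_finrank_eq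
  · rw [Submodule.span_le]
    rintro x ⟨i, rfl⟩
    refine Fin.cases ?_ (fun i => ?_) i
    · simpa using h2
    · refine Fin.cases ?_ (fun i => ?_) i
      · simpa using h1
      · simpa using huW i
  · rw [finrank_span_eq_card hli, hfin, Fintype.card_fin]
    omega

/-! ### Sorry-free glue, part 3: reindexing and the non-quadratic clause -/

/-- A transcendental number is not a root of a rational quadratic (the crux's non-quadratic
clause follows from the stronger transcendence delivered by `stub_shiftedTateBasis`). -/
theorem not_quadratic_of_transcendental {τ : ℂ} (hτ : Transcendental ℚ τ) (b c : ℚ) :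
    τ ^ 2 + (b : ℂ) * τ + (c : ℂ) ≠ 0 := by
  intro h
  apply hτ
  refine ⟨Polynomial.X ^ 2 + Polynomial.C b * Polynomial.X + Polynomial.C c, ?_, ?_⟩
  · exact Polynomial.Monic.ne_zero (by monicity!)
  · simp only [map_add, map_mul, map_pow, Polynomial.aeval_X, Polynomial.aeval_C, eq_ratCast]
    exact h

/-- Transport of a shifted Tate basis along `Fin (m + 2) = Fin N` (pure reindexing). -/
theorem tateBasis_transport {N m : ℕ} (h : N = m + 2) {S : Submodule ℚ ℂ} {w : Fin (m + 2) → ℂ}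
    (hw : LinearIndependent ℚ w) (hspan : Submodule.span ℚ (Set.range w) = S)
    (hre : ∀ j, (w j).re < 0)
    (htr : ∀ j, Transcendental ℚ (w j / (2 * (Real.pi : ℂ) * Complex.I)))
    (hmob : ∀ i j, i ≠ j → ∀ a b c d : ℚ, 0 < a * d - b * c →
      (w j / (2 * (Real.pi : ℂ) * Complex.I)) *
          ((c : ℂ) * (w i / (2 * (Real.pi : ℂ) * Complex.I)) + (d : ℂ)) ≠
        (a : ℂ) * (w i / (2 * (Real.pi : ℂ) * Complex.I)) + (b : ℂ)) :
    ∃ w' : Fin N → ℂ, LinearIndependent ℚ w' ∧ Submodule.span ℚ (Set.range w') = S ∧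
      (∀ j, (w' j).re < 0) ∧
      (∀ j, Transcendental ℚ (w' j / (2 * (Real.pi : ℂ) * Complex.I))) ∧
      (∀ i j, i ≠ j → ∀ a b c d : ℚ, 0 < a * d - b * c →
        (w' j / (2 * (Real.pi : ℂ) * Complex.I)) *
            ((c : ℂ) * (w' i / (2 * (Real.pi : ℂ) * Complex.I)) + (d : ℂ)) ≠
          (a : ℂ) * (w' i / (2 * (Real.pi : ℂ) * Complex.I)) + (b : ℂ)) := by
  subst h
  exact ⟨w, hw, hspan, hre, htr, hmob⟩

/-! ### The composition (concludes the crux BY NAME) -/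

/-- **`TateNomes.NomeHygiene`** from the two stubs: enlarge (`enlarge`, proved), re-base through
the periods (`periodBasis_exists`, proved), shift by natural numbers (`stub_shiftedTateBasis`,
fed the Key Lemma `stub_shiftCoincidence` by name), transport the index type along
`n + k = m + 2`, and read off the seven conjuncts of the crux. -/
theorem NomeHygiene_of : Summit.Schanuel.Schanuel.Theses.TateNomes.NomeHygiene := by
  intro n z hz
  obtain ⟨k, N, e, v, hN, he, hv, hr, h1, h2pi, h3⟩ := enlarge n z hz
  obtain ⟨m, u, hNm, hu, hspanu⟩ := periodBasis_exists N v hv h1 h2pi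
  have hm : 1 ≤ m := by omega
  obtain ⟨w₀, hw₀, hspan₀, hre₀, htr₀, hmob₀⟩ :=
    stub_shiftedTateBasis stub_shiftCoincidence m u hm hu
  obtain ⟨w, hw, hspan, hre, htr, hmob⟩ :=
    tateBasis_transport (N := n + k) (by omega) hw₀ (hspan₀.trans hspanu) hre₀ htr₀ hmob₀
  refine ⟨k, e, w, he, hw, ?_, ?_, hre, ?_, hmob⟩
  · rw [hspan, hr]
  · rw [hspan]
    exact h2pi
  · intro j b c
    exact not_quadratic_of_transcendental (htr j) b c

end Summit.Schanuel.Schanuel.Cruxes.NomeHygiene.IntegerShiftRebase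

end
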